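import Literature.MathematicalPhysics.QuantumFieldTheory.Balaban1983to89.B4Lemma22RegFieldFam
import Literature.MathematicalPhysics.QuantumFieldTheory.Balaban1983to89.B4Eq12ExpFlow

/-!
# [B4] LEMMA 2.2, THE TYPED LEAVES AT `A ≠ 0` FOR THE PRINTED LINK VARIABLES «U(A) = e^{qeηA}» (EVERY antisymmetric
# `q`, and the rotation flow), AND NON-CONSTANT WITNESSES OF THE TYPED ANTECEDENTS [Balaban1983RegularityDecay]

statement-level skeleton of published theorems with citation tags; proofs where landed; nothing here is a claim about the Yang–Mills mass gap

CITATION HEADER.  T. Bałaban, *Regularity and decay of lattice Green's functions*, Commun. Math. Phys. **89** (1983)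
571–597, doi:10.1007/bf01214744 [Balaban1983RegularityDecay] (cell paper B4; held text
`paper:balaban1983-cmp89-regularity-decay`, journal page = PDF page + 570; pp. 572, 573, 577–578).  PDF held: yes.  Unit
`lit-balaban-p35` gen 7 (Phase-2 proof seat), HOME `run/shared/lean/pub/lit-balaban/`.  WHAT IS REPRODUCED: SKELETON row
**B4.Lem2.2** — the two typed leaves of gen 7 (`B4Lemma22RegularCubeFam.lemma22Printed_cubeFieldFam`: cube
configurations `Ã_j`; `B4Lemma22RegFieldFam.lemma22Printed_regFieldFam`: every regular `Ã` constant on the collar)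
with their FLOW HYPOTHESES DISCHARGED for the printed link variables (1.2) «U(A) = e^{qeηA}, q antisymmetric» (r01's
`B4Eq12ExpFlow.expFlow`, any `N`) and for the rotation flow (`N = 2`), in the style of
`B4Eq12ExpFlow.lemma21Printed_regularRegion_exp` / `B4Lemma21Region.lemma21Printed_regularRegion_rot`; and
NON-VACUITY BY NON-CONSTANT FIELDS (the linear field for the cube family, a bump field for the general family), in the
style of `B4Lemma21Region`'s linear-field instance.  Imports `B4Lemma22RegFieldFam` (→ `B4Lemma22RegularCubeFam`) and
r01's `B4Eq12ExpFlow`.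

WHAT IS PRINTED.  p. 572 (1.2): «U(A) = e^{qeηA}, where q is an antisymmetric N×N matrix»; pp. 577–578 Lemma 2.2 (see
the two family files); p. 573 (1.7): «|(∂^η_μA)(x)| ≤ ce^{β−1}».

WHAT THIS MODULE PROVES (theorems only).
* `lemma22Printed_cubeFieldFam_exp` / `lemma22Printed_regFieldFam_exp` — `B4.Lemma22Printed` on both families for the
  flow `e^{tq}` of (1.2), EVERY antisymmetric `q` (Lipschitz constant `(Σq_{ij}²)^{1/2}`, `B4Eq12ExpFlow.expFlow_lipschitz`).
* `lemma22Printed_cubeFieldFam_rot` / `lemma22Printed_regFieldFam_rot` — the same for the rotation flow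
  (`B4Lower18Regular.rot_lipschitz`).
* `antecedents_met_linear` — cube family: below every threshold a member with the NON-CONSTANT linear field
  `A_ν(x) = λx_0`, `λ = c·e^{β−1}η`, meets all typed antecedents ((1.7) with equality in direction `0`).
* `antecedents_met_bump` — general family: below every threshold a member with the NON-CONSTANT bump field
  `A_ν(x) = λ·1_{x = x₀}` at an interior site meets all typed antecedents ((1.7) and the collar constancy).

HONEST SCOPE.  Corollaries and witnesses only; the content is in the two family files and in r01's `B4Eq12ExpFlow`.
No `def`, no `Prop` fact, no `sorry`; axioms standard.
-/

namespace Literature.MathematicalPhysics.QuantumFieldTheory.Balaban1983to89.B4Lemma22RegFlows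

open Finset Matrix
open Literature.MathematicalPhysics.QuantumFieldTheory.Balaban1983to89.B4 (Lemma22Printed)
open Literature.MathematicalPhysics.QuantumFieldTheory.Balaban1983to89.B4GaugeCovariance
open Literature.MathematicalPhysics.QuantumFieldTheory.Balaban1983to89.B4Reflection242 (boxDom mem_boxDom)
open Literature.MathematicalPhysics.QuantumFieldTheory.Balaban1983to89.B4Lower18Regular (e1 e1_apply_self e1_apply_ne
  rot_lipschitz)
open Literature.MathematicalPhysics.QuantumFieldTheory.Balaban1983to89.B4Lemma22ReduceZero (Box)
open Literature.MathematicalPhysics.QuantumFieldTheory.Balaban1983to89.B4Eq12ExpFlow (expFlow expFlow_lipschitz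
  expFlow_ell_nonneg)
open Literature.MathematicalPhysics.QuantumFieldTheory.Balaban1983to89.B4Lemma22RegularCubeFam (RegInst cubeFieldFam
  lemma22Printed_cubeFieldFam)
open Literature.MathematicalPhysics.QuantumFieldTheory.Balaban1983to89.B4Lemma22RegFieldFam (RegFieldInst regFieldFam
  lemma22Printed_regFieldFam)

noncomputable section

variable {ι : Type} [Fintype ι] [DecidableEq ι]

/-! ## §1. The typed leaves for the printed flows -/

/-- **LEMMA 2.2 TYPED, CUBE-CONFIGURATION FAMILY, FOR THE FLOW `U = e^{tq}` OF (1.2) WITH ANY ANTISYMMETRIC `q`** —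
hypothesis-free in the flow. [cite: Balaban1983RegularityDecay, Lemma 2.2 (2.16)–(2.17) pp. 577–578; (1.2) p. 572] -/
theorem lemma22Printed_cubeFieldFam_exp (q : Matrix ι ι ℝ) (hq : qᵀ = -q) (d ℓ : ℕ) (hℓ : 1 ≤ ℓ)
    (amin aplus m2plus : ℝ) (ha : 0 < amin) (creg β : ℝ) (hcreg : 0 ≤ creg) (hβ : 0 < β) (S K : ℕ) (hK : 1 ≤ K) :
    Lemma22Printed (cubeFieldFam (expFlow q hq) d ℓ amin aplus m2plus creg β S K) (d + 1) :=
  lemma22Printed_cubeFieldFam (expFlow q hq) (expFlow_ell_nonneg q) (expFlow_lipschitz q hq) d ℓ hℓ amin aplus m2plus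
    ha creg β hcreg hβ S K hK

/-- **LEMMA 2.2 TYPED, GENERAL REGULAR-FIELD FAMILY, FOR THE FLOW `U = e^{tq}` OF (1.2) WITH ANY ANTISYMMETRIC `q`** —
hypothesis-free in the flow. [cite: Balaban1983RegularityDecay, Lemma 2.2 (2.16)–(2.17) pp. 577–578; (1.2) p. 572] -/
theorem lemma22Printed_regFieldFam_exp (q : Matrix ι ι ℝ) (hq : qᵀ = -q) (d ℓ : ℕ) (hℓ : 1 ≤ ℓ)
    (amin aplus m2plus : ℝ) (ha : 0 < amin) (creg β : ℝ) (hcreg : 0 ≤ creg) (hβ : 0 < β) (S : ℕ) :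
    Lemma22Printed (regFieldFam (expFlow q hq) d ℓ amin aplus m2plus creg β S) (d + 1) :=
  lemma22Printed_regFieldFam (expFlow q hq) (expFlow_ell_nonneg q) (expFlow_lipschitz q hq) d ℓ hℓ amin aplus m2plus
    ha creg β hcreg hβ S

/-- Lemma 2.2 typed on the cube-configuration family for the ROTATION FLOW (`N = 2`): a hypothesis-free instance of
the flow assumptions. [cite: Balaban1983RegularityDecay, Lemma 2.2 (2.16)–(2.17) pp. 577–578] -/
theorem lemma22Printed_cubeFieldFam_rot (d ℓ : ℕ) (hℓ : 1 ≤ ℓ) (amin aplus m2plus : ℝ) (ha : 0 < amin)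
    (creg β : ℝ) (hcreg : 0 ≤ creg) (hβ : 0 < β) (S K : ℕ) (hK : 1 ≤ K) :
    Lemma22Printed (cubeFieldFam OrthFlow.rot d ℓ amin aplus m2plus creg β S K) (d + 1) :=
  lemma22Printed_cubeFieldFam OrthFlow.rot zero_le_one rot_lipschitz d ℓ hℓ amin aplus m2plus ha creg β hcreg hβ S K hK

/-- Lemma 2.2 typed on the general regular-field family for the ROTATION FLOW (`N = 2`).
[cite: Balaban1983RegularityDecay, Lemma 2.2 (2.16)–(2.17) pp. 577–578] -/
theorem lemma22Printed_regFieldFam_rot (d ℓ : ℕ) (hℓ : 1 ≤ ℓ) (amin aplus m2plus : ℝ) (ha : 0 < amin)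
    (creg β : ℝ) (hcreg : 0 ≤ creg) (hβ : 0 < β) (S : ℕ) :
    Lemma22Printed (regFieldFam OrthFlow.rot d ℓ amin aplus m2plus creg β S) (d + 1) :=
  lemma22Printed_regFieldFam OrthFlow.rot zero_le_one rot_lipschitz d ℓ hℓ amin aplus m2plus ha creg β hcreg hβ S

/-! ## §2. Non-vacuity by non-constant fields -/

section Witnesses

variable (F : OrthFlow ι) {d ℓ : ℕ} {amin aplus m2plus : ℝ} (creg β : ℝ)

/-- **THE CUBE FAMILY'S ANTECEDENTS ARE MET BY A NON-CONSTANT FIELD BELOW EVERY THRESHOLD**: the cube `□_j` itself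
(`M_μ = 2K`, `j_μ = 1`, scale `k = 4`) with the LINEAR field `A_ν(x) = λx_0`, `λ = c·e₁^{β−1}η` (which attains the bound
(1.7) in direction `0`), charge `e = e₁`; for `c > 0` the field is not constant.
[cite: Balaban1983RegularityDecay, Lemma 2.2 pp. 577–578 with (1.7) p. 573, dictionary] -/
theorem antecedents_met_linear {S K : ℕ} (hℓ : 1 ≤ ℓ) (hap : amin ≤ aplus) (hm2 : 0 ≤ m2plus) (hK1 : 1 ≤ K) (hSK : 2 * K ≤ S)
    (hcreg : 0 < creg) {e₁ : ℝ} (he₁ : 0 < e₁) :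
    ∃ i : RegInst d ℓ amin aplus m2plus K,
      (cubeFieldFam F d ℓ amin aplus m2plus creg β S K i).rect ∧
      (cubeFieldFam F d ℓ amin aplus m2plus creg β S K i).fewLargeBlocks ∧
      (cubeFieldFam F d ℓ amin aplus m2plus creg β S K i).regular ∧
      (cubeFieldFam F d ℓ amin aplus m2plus creg β S K i).constNearBdry ∧
      0 < (cubeFieldFam F d ℓ amin aplus m2plus creg β S K i).e ∧
      (cubeFieldFam F d ℓ amin aplus m2plus creg β S K i).e ≤ e₁ ∧
      i.Ac (e1 0) 0 ≠ i.Ac 0 0 := by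
  have h16 : 16 ≤ (ℓ + 1) ^ 4 * K := by
    have h1 : 2 ^ 4 ≤ (ℓ + 1) ^ 4 := Nat.pow_le_pow_left (by omega) 4
    calc 16 = 2 ^ 4 * 1 := by norm_num
      _ ≤ (ℓ + 1) ^ 4 * K := Nat.mul_le_mul h1 hK1
  set lam : ℝ := creg * e₁ ^ (β - 1) / ((ℓ + 1) ^ 4 : ℕ) with hlam
  have hn : (0 : ℝ) < ((ℓ + 1) ^ 4 : ℕ) := by positivity
  have hlam0 : 0 < lam := by
    have := Real.rpow_pos_of_pos he₁ (β - 1)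
    rw [hlam]; positivity
  refine ⟨⟨4, by norm_num, h16, amin, le_rfl, hap, 0, le_rfl, hm2, fun _ => 2 * K, fun _ => by show 1 ≤ 2 * K; omega,
    fun _ => 1, fun x _ => lam * (x 0 : ℝ), e₁⟩, trivial, fun _ => hSK, ?_, ⟨fun _ => le_rfl, fun _ => by
      show (K : ℤ) * (1 + 1) ≤ ((2 * K : ℕ) : ℤ); push_cast; omega⟩, he₁, le_rfl, ?_⟩
  · intro x _ μ ν
    show |lam * ((x + e1 μ) 0 : ℝ) - lam * (x 0 : ℝ)| ≤ creg * e₁ ^ (β - 1) / ((ℓ + 1) ^ 4 : ℕ)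
    rw [← hlam, ← mul_sub, abs_mul, abs_of_pos hlam0]
    have h01 : |(((x + e1 μ) 0 : ℤ) : ℝ) - (x 0 : ℝ)| ≤ 1 := by
      by_cases hμ : μ = 0
      · subst hμ
        simp only [Pi.add_apply, e1_apply_self, Int.cast_add, Int.cast_one, add_sub_cancel_left, abs_one, le_refl]
      · rw [Pi.add_apply, e1_apply_ne (Ne.symm hμ), add_zero, sub_self, abs_zero]
        exact zero_le_one
    calc lam * |(((x + e1 μ) 0 : ℤ) : ℝ) - (x 0 : ℝ)| ≤ lam * 1 := mul_le_mul_of_nonneg_left h01 hlam0.le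
      _ = lam := mul_one _
  · show lam * ((e1 (0 : Fin (d + 1)) 0 : ℤ) : ℝ) ≠ lam * ((0 : Fin (d + 1) → ℤ) 0 : ℝ)
    rw [e1_apply_self, Pi.zero_apply, Int.cast_one, Int.cast_zero, mul_one, mul_zero]
    exact hlam0.ne'

/-- **THE GENERAL FAMILY'S ANTECEDENTS ARE MET BY A NON-CONSTANT FIELD BELOW EVERY THRESHOLD**: the box `M_μ = 3` at
scale `k = 1` with the BUMP field `A_ν(x) = λ·1_{x = x₀}` at the interior site `x₀ = (2,…,2)`, `λ = c·e₁^{β−1}η` (it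
satisfies (1.7) and is constant — zero — on the boundary collar), charge `e = e₁`; for `c > 0` it is not constant.
[cite: Balaban1983RegularityDecay, Lemma 2.2 pp. 577–578 with (1.7) p. 573, dictionary] -/
theorem antecedents_met_bump {S : ℕ} (hℓ : 1 ≤ ℓ) (hap : amin ≤ aplus) (hm2 : 0 ≤ m2plus) (hS3 : 3 ≤ S)
    (hcreg : 0 < creg) {e₁ : ℝ} (he₁ : 0 < e₁) :
    ∃ i : RegFieldInst d ℓ amin aplus m2plus,
      (regFieldFam F d ℓ amin aplus m2plus creg β S i).rect ∧
      (regFieldFam F d ℓ amin aplus m2plus creg β S i).fewLargeBlocks ∧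
      (regFieldFam F d ℓ amin aplus m2plus creg β S i).regular ∧
      (regFieldFam F d ℓ amin aplus m2plus creg β S i).constNearBdry ∧
      0 < (regFieldFam F d ℓ amin aplus m2plus creg β S i).e ∧
      (regFieldFam F d ℓ amin aplus m2plus creg β S i).e ≤ e₁ ∧
      i.Ac (fun _ => 2) 0 ≠ i.Ac 0 0 := by
  classical
  set lam : ℝ := creg * e₁ ^ (β - 1) / ((ℓ + 1) ^ 1 : ℕ) with hlam
  have hlam0 : 0 < lam := by
    have := Real.rpow_pos_of_pos he₁ (β - 1)
    rw [hlam]; positivity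
  set x₀ : Fin (d + 1) → ℤ := fun _ => 2 with hx₀
  refine ⟨⟨1, le_rfl, amin, le_rfl, hap, 0, le_rfl, hm2, fun _ => 3, fun _ => by norm_num,
    fun x _ => if x = x₀ then lam else 0, e₁⟩, trivial, fun _ => hS3, ?_, ?_, he₁, le_rfl, ?_⟩
  · -- (1.7): values in `{0, λ}`
    intro x _ μ ν
    show |(if x + e1 μ = x₀ then lam else 0) - (if x = x₀ then lam else 0)| ≤ creg * e₁ ^ (β - 1) / ((ℓ + 1) ^ 1 : ℕ)
    rw [← hlam]
    split_ifs <;> simp [abs_of_pos hlam0, hlam0.le]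
  · -- the collar constancy: the bump sits off the collar, the corner is off the bump
    intro x _ μ hxμ ν
    have hx : x ≠ x₀ := by
      rintro rfl
      simp only [hx₀] at hxμ
      push_cast at hxμ
      have : 2 ≤ ℓ + 1 := by omega
      rcases hxμ with h | h
      · norm_num at h
      · simp only [pow_one] at h
        omega
    have h0 : (0 : Fin (d + 1) → ℤ) ≠ x₀ := by
      intro h
      have := congrFun h 0
      simp [hx₀] at this
    show (if x = x₀ then lam else 0) = (if (0 : Fin (d + 1) → ℤ) = x₀ then lam else 0)
    rw [if_neg hx, if_neg h0]
  · show (if x₀ = x₀ then lam else 0) ≠ (if (0 : Fin (d + 1) → ℤ) = x₀ then lam else 0)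
    have h0 : (0 : Fin (d + 1) → ℤ) ≠ x₀ := by
      intro h
      have := congrFun h 0
      simp [hx₀] at this
    rw [if_pos rfl, if_neg h0]
    exact hlam0.ne'

end Witnesses

end

end Literature.MathematicalPhysics.QuantumFieldTheory.Balaban1983to89.B4Lemma22RegFlows
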